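import Summits.BirchSwinnertonDyer.BirchSwinnertonDyer.Theorems.ClassRecordThreeKolyGlue
import Summits.BirchSwinnertonDyer.Rank1Residual.X11b.KolyvaginShaOrderByName
import HarnessLib

/-!
# Route `KolyvaginRoadThree`, atom A1: the Kolyvagin-road kernel `Koly.bsdp_three_onA1_of_kolyvaginFrames`
# (p410690) WITHOUT the quantitative Kolyvagin named fact — its binder
# `hB : ∀ N W K, Kolyvagin1990_padicValNat_card_sha_le N W K` REPLACED by two Gross 1991 named facts and the
# route's levelwise Cassels–Tate item (`--supports stmt-BirchSwinnertonDyer-19415`)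

Cell `b2b-bsdres`, seat x11b3-p2 GEN 55 (unit claimed D-0075 → BSD:K2/P4 «Kolyvagin-in-kernel»).
Summit-side THEOREM-ONLY helper file (no definition, no named fact, no `sorry`).  LINE (D-0145): the declared
support item stmt-BirchSwinnertonDyer-19415 `ClassicalInputsKolyThree` of route `KolyvaginRoadThree` (the
families conjunct of `PublishedInputsKolyThree`, whose conjunct 3 is Kolyvagin's INDEX bound) together with the
route's item stmt-BirchSwinnertonDyer-20191 `ShimuraCasselsTateLevelInputs` (= `∀ K, casselsTate_levelInputs K`).

HONEST FRAMING (cell `b2b-bsdres`, run/shared/lean/b2b/bsd-rank1-residual/, verbatim in every file): the goal of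
the cell is to DELETE the COMBINATION-SHAPED residual classes of the Birch–Swinnerton-Dyer formula for ALL
analytic-rank `≤ 1` elliptic curves over `ℚ` — "full BSD formula for every rank `≤ 1` curve in class `C`"
assembled STRICTLY from published theorems — so that the rank-`≤ 1` remainder becomes exactly the
CONSTRUCTION-SHAPED classes, which are TYPED (missing-input `Prop`s), NOT attempted.  This is not "finishing
BSD".  Nothing here is booked; no mark / label / count / tier moves; the crux `ZhangSharpFrameAtThree` (seam G-b,
binder `hZ`) and seam G-a (`hKD`) stay HYPOTHESES exactly as in the original kernel; BSD is not proved by any of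
this; no census number moves (T7).

WHAT THIS FILE DOES.  `Koly.bsdp_three_onA1_of_kolyvaginFrames` (`Theorems/ClassRecordThreeKolyGlue.lean`, koly
g6, p410690) decides `BSD(E,3)` on atom A1 = (ram) ∧ `3 ∤ ∏c` of class X11b @ 3 from the published named facts,
the two seams and — as binder `hB` — the quantitative Kolyvagin theorem `∀ N W K, Kolyvagin1990_padicValNat_card_sha_le N W K`,
which it USES ONCE, at `(N_E, W, K)` for the odd Hoffstein–Luo Heegner field `K` it picks (`d_K` odd, `3 ∤ d_K`,
so `d_K ∉ {−3, −4}`; `W` globally minimal; multiplicative at 3, so no CM).  At exactly that shape the bound is the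
x11b3 KERNEL theorem `KolyvaginDischarged.kolyvagin1990_padicValNat_card_sha_le_of_classX11b_of_namedFacts`
(`X11b/KolyvaginShaOrderByName.lean`, GEN 55: McCallum 1991 §§1–5 and Gross 1991 §§3–6 transcribed in the tree)
from `kolyvagin` (already the kernel's `hKo`), `Gross1991_heegnerPoint_sub_ratTorsion_mem_E0` (Gross §6 ∕
[GZ86 III (3.1)]), `GrossLMS1991.prop37_2_frobeniusCongruence` (Prop. 3.7 (2), closed image-free print) and
`∀ K, casselsTate_levelInputs K` (route item 20191).  THIS FILE re-runs the kernel VERBATIM with `hB` replaced by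
those three binders (`hE0`, `hγ`, `hCT`); every other binder, the proof and the conclusion
(`ClassX11b W 3 → Ram W 3 → ¬ 3 ∣ ∏c → BSDp W 3`) are p410690's, byte for byte.  Net for the planner (their pen,
not this file's): on A1 the support conjunct `Kolyvagin1990_padicValNat_card_sha_le` is replaceable by two HELD
printed inputs BY LITERATURE DECL NAME (E0, Prop. 3.7 (2)) plus the existing item 20191.  CONDITIONAL on every
binder (PUBLISHED facts NOT discharged; seams G-a ∕ G-b hypotheses); nothing booked.

References: [cite: McCallumLMS1991, §1 Theorem (Kolyvagin), §5 Thm. 5.4, Cor. 5.6 (p. 310)]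
[cite: GrossLMS1991, Thm. 1.3, §3 Prop. 3.7 (2), §4 (4.1), §6 Prop. 6.2 (1)] [cite: MilneADT2006, Ch. I §6, Thm. 6.13(a)]
[cite: JetchevSkinnerWan2017, §7.4.1–7.4.2 (pp. 30–31)] [cite: KolyvaginEulerSystems1990, Thm. A]
-/

noncomputable section

open scoped Classical

-- Same namespace as the original kernel (`Theorems/ClassRecordThreeKolyGlue.lean`).
namespace Summit.BirchSwinnertonDyer.Rank1Residual.X11b.Three.Koly

open WeierstrassCurve Literature.NumberTheory.EllipticCurves
  Literature.NumberTheory.EllipticCurves.ModularForms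
  Literature.NumberTheory.EllipticCurves.Rank1Residual
  Literature.NumberTheory.EllipticCurves.GrossLMS1991
  Summit.BirchSwinnertonDyer.Rank1Residual Summit.BirchSwinnertonDyer.Rank1Residual.X11b

/-- **The A1 Kolyvagin-road kernel WITHOUT the quantitative Kolyvagin named fact.**  Under the published named
facts of `Koly.bsdp_three_onA1_of_kolyvaginFrames` MINUS `Kolyvagin1990_padicValNat_card_sha_le` PLUS
{`Gross1991_heegnerPoint_sub_ratTorsion_mem_E0`, `prop37_2_frobeniusCongruence`, `∀ K, casselsTate_levelInputs K`},
the two seams `hKD` (G-a: conductor-1 Kolyvagin–Heegner data on admissible frames) and `hZ` (G-b: Kolyvagin's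
conjecture mod 3 at every Manin-good frame = crux `ZhangSharpFrameAtThree`): for every `E/ℚ` with
`(E,3) ∈ X11b`, a (ram) prime and `3 ∤ ∏_ℓ c_ℓ(E)`, `BSDp W 3`.  Proof = p410690's VERBATIM, the single use of
`hB` at the odd Heegner field fed by `KolyvaginDischarged.kolyvagin1990_padicValNat_card_sha_le_of_classX11b_of_namedFacts`
(`d_K` odd and `3 ∤ d_K` give `d_K ∉ {−3, −4}`).  CONDITIONAL on every binder; nothing booked; no mark / count /
tier moves. [cite: McCallumLMS1991, §1 Theorem (Kolyvagin), §5 Cor. 5.6 (p. 310)]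
[cite: GrossLMS1991, §4 (4.1), Thm. 1.3, §3 Prop. 3.7 (2), §6 Prop. 6.2 (1)]
[cite: JetchevSkinnerWan2017, §7.4.1–7.4.2 (pp. 30–31)] [cite: MilneADT2006, Ch. I §6, Thm. 6.13(a)] -/
theorem bsdp_three_onA1_of_kolyvaginFrames_of_gross1991_of_casselsTateLevelInputs
    -- published named facts
    (hGZ : ∀ (N : ℕ) [NeZero N] (W : WeierstrassCurve ℚ) (K : Type) [Field K] [NumberField K],
      gross_zagier N W K)
    (hKo : ∀ (N : ℕ) [NeZero N] (W : WeierstrassCurve ℚ) (K : Type) [Field K] [NumberField K],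
      kolyvagin N W K)
    -- IN PLACE OF `hB : ∀ N W K, Kolyvagin1990_padicValNat_card_sha_le N W K` (x11b3-p2 GEN 55, p573118):
    (hE0 : Gross1991_heegnerPoint_sub_ratTorsion_mem_E0) (hγ : prop37_2_frobeniusCongruence)
    (hCT : ∀ (K : Type) [Field K] [NumberField K], casselsTate_levelInputs K)
    (hSk : Skinner2016.thmC_padicValRat_bsd_rank_zero)
    (hGZK : rank_eq_analyticRank_of_analyticRank_le_one) (hmod : hasEntireLFunction_rat)
    (hnf : exists_isNewformOf) (hHL : HoffsteinLuo1997_exists_twist_L_one_ne_zero)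
    (hMaz : mazur_not_dvd_maninConstant_of_odd)
    (hrec : ∀ (N : ℕ) [NeZero N] (W : WeierstrassCurve ℚ) (K : Type) [Field K] [NumberField K],
      heegnerPointOfConductor_one_galoisConj N W K)
    (hMc : McCallum1991_pow_dvd_card_sha_primary_of_certificate)
    -- SEAM G-a: conductor-1 Kolyvagin–Heegner data exist on every admissible frame (CM theory; hypothesis shape)
    (hKD : ∀ (W : WeierstrassCurve ℚ) [W.IsElliptic] [W.IsGloballyMinimal] [NeZero (W.conductorNorm ℤ)]
      (K : Type) [Field K] [NumberField K]
      (Dt : ModularParametrizationData W (W.conductorNorm ℤ)) (β : ℤ) (ι : K →+* ℂ),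
      IsImaginaryQuadratic K → SatisfiesHeegnerHypothesis (W.conductorNorm ℤ) K →
      (4 * (W.conductorNorm ℤ : ℤ)) ∣ β ^ 2 - NumberField.discr K →
      Nonempty (KolyvaginHeegnerData Dt β ι 1))
    -- SEAM G-b: Kolyvagin's conjecture mod 3 at 3 ∥ N at EVERY Manin-good frame (hypothesis shape, ∀-form of Z₃♯)
    (hZ : ∀ (W : WeierstrassCurve ℚ) [W.IsElliptic] [W.IsGloballyMinimal] [NeZero (W.conductorNorm ℤ)]
      (K : Type) [Field K] [NumberField K]
      (Dt : ModularParametrizationData W (W.conductorNorm ℤ)) (β : ℤ) (ι : K →+* ℂ),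
      W.HasMultiplicativeReductionAtPrime 3 → W.HasSurjectiveModNGaloisRep 3 →
      (∃ (ℓ : ℕ) (_ : Fact ℓ.Prime), ℓ ≠ 3 ∧ W.HasMultiplicativeReductionAtPrime ℓ ∧
        ¬ 3 ∣ padicValInt ℓ W.minimalDiscriminantInt) →
      ¬ 3 ∣ W.tamagawaProduct →
      IsImaginaryQuadratic K → SatisfiesHeegnerHypothesis (W.conductorNorm ℤ) K →
      NumberField.discr K ≠ -3 →
      (4 * (W.conductorNorm ℤ : ℤ)) ∣ β ^ 2 - NumberField.discr K → ¬ (3 : ℤ) ∣ Dt.c →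
      ∃ (n : ℕ) (d : KolyvaginHeegnerData Dt β ι n),
        KolyvaginDescent.KolSupp (Zhang2014.IsKolyvaginPrime (W.conductorNorm ℤ) W K 3) n ∧
          d.kolyvaginClass Nat.prime_three 1 ≠ 0)
    -- the pair
    (W : WeierstrassCurve ℚ) [W.IsElliptic] [W.IsGloballyMinimal]
    (hX : ClassX11b W 3) (hram : Ram W 3) (htam : ¬ 3 ∣ W.tamagawaProduct) : BSDp W 3 := by
  haveI : NeZero (W.conductorNorm ℤ) := ⟨(W.conductorNorm_pos_holds).ne'⟩
  have hmult : W.HasMultiplicativeReductionAtPrime 3 := hX.2.2.1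
  have hirr : Irr W 3 := hX.2.2.2
  have hρ : Surj W 3 := surj_of_irr_of_ram W 3 hirr hram
  -- ONE odd Heegner datum with a Manin-good frame (Hoffstein–Luo field; Mazur; w_K = 2)
  obtain ⟨K, _, _, Dt, H, ι, P, Wd, _, _, Cd, hK, hodd, h3d, hHN, hP, hc, hμ, hLt, hWd⟩ :=
    exists_oddHeegnerData hnf hHL hMaz integral_neronScaling_of_isGloballyMinimal_holds W 3 hX.1
      (by decide) hmult hirr
  have h3 : NumberField.discr K ≠ -3 := by
    intro h
    exact h3d (h ▸ ⟨-1, by norm_num⟩)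
  -- seam G-a: a conductor-1 Kolyvagin–Heegner datum on the frame (Dt, H.β, ι)
  obtain ⟨d₁⟩ := hKD W K Dt H.β ι hK hHN H.dvd_sq_sub
  -- the bottom point: P(1) = y_K = P in E(K̄) (Shimura reciprocity at conductor 1, named fact `hrec`)
  have hPd : d₁.toGeomPoints d₁.derivedPoint = toGeomPoints (W.baseChange K) P :=
    KolyvaginBottom.toGeomPoints_derivedPoint_one_eq (hrec _ W K) hK hHN hP d₁ rfl
  -- y_K is non-torsion (Gross–Zagier at r_an = 1 with L(E^{d_K},1) ≠ 0); rank one, Ш finite (Kolyvagin)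
  have hPinf : ¬ IsOfFinAddOrder P :=
    not_isOfFinAddOrder_of_heegner_of_analyticRank_eq_one W (W.conductorNorm ℤ) K Dt H ι P (hGZ _ W K) hmod
      hX.1 hK hHN hLt hP
  obtain ⟨hrank, hSha⟩ := hKo (W.conductorNorm ℤ) W K hK hHN ⟨Dt, H, ι, hP⟩ hPinf
  haveI : Finite (W.baseChange K).sha := hSha
  -- E(K)[3] = 0 (E[3] irreducible, K imaginary quadratic)
  have hbot := torsionBy_eq_bot_of_isImaginaryQuadratic_of_hasIrreducibleModPGaloisRep W K hK
    Nat.prime_three hirr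
  have hiv : ∀ x : (W.baseChange K).toAffine.Point, 3 • x = 0 → x = 0 := fun x hx ↦ by
    have hmem : x ∈ AddSubgroup.torsionBy (W.baseChange K).toAffine.Point ((3 : ℕ) : ℤ) := by
      rw [mem_torsionBy_iff, natCast_zsmul]
      exact hx
    rw [hbot] at hmem
    exact hmem
  -- the exponent 3^{M₀} ∥ y_K (Mordell–Weil)
  haveI : Module.Finite ℤ (W.baseChange K).toAffine.Point := (W.baseChange K).module_finite_point_holds
  obtain ⟨M₀, x₀, hx₀, hmax⟩ := exists_pow_smul_eq_and_forall_ne hPinf (p := 3) (by norm_num)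
  have hdiv : ∃ Q : (W.baseChange K).toAffine.Point, ((3 ^ M₀ : ℕ) : ℤ) • Q = P :=
    ⟨x₀, by rw [natCast_zsmul]; exact hx₀⟩
  have hndiv : ¬ ∃ Q : (W.baseChange K).toAffine.Point, ((3 ^ (M₀ + 1) : ℕ) : ℤ) • Q = P := by
    rintro ⟨Q, hQ⟩
    exact hmax Q (by rw [← natCast_zsmul]; exact hQ)
  -- seam G-b: Kolyvagin's conjecture mod 3 at this Manin-good frame
  obtain ⟨n, d, hn, hne⟩ := hZ W K Dt H.β ι hmult hρ hram htam hK hHN h3 H.dvd_sq_sub hc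
  -- Kolyvagin's INDEX bound at THIS (N_E, W, K) — NOT a named fact here: the x11b3 kernel theorem BY NAME
  -- (`KolyvaginShaOrderByName`, GEN 55) from `kolyvagin`, Gross 1991 §6 / Prop. 3.7 (2) and `casselsTate_levelInputs`
  have hB' : Kolyvagin1990_padicValNat_card_sha_le (W.conductorNorm ℤ) W K :=
    KolyvaginDischarged.kolyvagin1990_padicValNat_card_sha_le_of_classX11b_of_namedFacts hKo hE0 hγ hCT W hX K
      ⟨h3, fun h4 ↦ by obtain ⟨k, hk⟩ := hodd; rw [h4] at hk; omega⟩
  -- the end-to-end theorem at this datum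
  exact ClassX11b.bsdp_three_of_kolyvaginClass_one_ne_zero_of_mccallum W K Dt H ι P (hGZ _ W K) (hKo _ W K)
    (hB') hSk hGZK hmod hX hram htam hK hodd hHN hP hc hLt Wd Cd hWd H.β d₁ hPd hPinf hrank hiv hdiv hndiv
    d hn hne hMc

end Summit.BirchSwinnertonDyer.Rank1Residual.X11b.Three.Koly

end
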